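/-
Copyright (c) 2026. All rights reserved.
Released under Apache 2.0 license as described in the file LICENSE.
Authors: abc-iut cell, seat abc-iut-w5-d144 (gen 5; row «PI1-TORUS-MINUS-FINITE», consumer part: the
Möbius deck group of an elliptic curve minus a non-empty finite set is FREE of rank `|S| + 1`, and the
geometric column of [AbsTopIII] Prop 4.2 (i) / Cor 4.5 fires at every curve of type `(1, r)`).
-/
import Literature.AnabelianGeometry.AbsoluteAnabelian.ArchimedeanHolFieldFunctorGeometricPSLUniformisedBaseFree
import Literature.AlgebraicTopology.FundamentalGroup.TorusMinusFiniteFundamentalGroup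
import HarnessLib

/-!
# The Möbius deck group of a curve of type `(1, r)` is free of rank `r + 1`; [AbsTopIII] Prop 4.2 (i) /
# Cor 4.5 at every elliptic curve minus a non-empty finite set (PROOF-ONLY)

Topic `Literature/AnabelianGeometry/AbsoluteAnabelian`; sequel of abc-iut-w6-d031's uniformised-base
junction (`…PSLUniformisedBase`, `…PSLUniformisedBaseFree`) in the geometric column of S. Mochizuki,
*Topics in absolute anabelian geometry III*, proof of Prop 4.2 (i), kurims p.106 l.11–19 («the full
subcategory of `EA` consisting of objects that map to `X` … may be identified with … `Loc_R(X)` … [is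
id-rigid by] the slimness assertion of Lemma 4.3»), Cor 4.5 pp.107–109, for the hyperbolic curves of
type `(1, r)`, `r ≥ 1` — a compact genus-one Riemann surface minus `r` points (e.g. IUT's `X̲_v` of type
`(1, ℓ)` at an archimedean place).  abc-iut-w6-d031 put every such curve at the base `X₀ = ℍ/Λ̄` of
abc-iut-L4-t14's column (`exists_pslQuotient_iso_of_biholomorphic_torus_minus_finite`: `pslQuotient Λ̄ ≅ X`,
`Λ̄ ≃* π₁(X)`) and recorded the FREENESS of `Λ̄` only for `(0, r)` and `(1, 1)`.  The tree's new
computation `π₁((ℝ/ℤ)² ∖ S) ≅ F_{|S|+1}` (`TorusMinusFinite.nonempty_mulEquiv_freeGroup_compl_finite`,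
Hatcher Ex. 1.22) supplies the missing rank for all `r`:

* `HolRS.nonempty_mulEquiv_freeGroup_of_homeomorph_torus_compl_finite` — `π₁(Y, y) ≅ F_{|S|+1}` for any
  space `Y` homeomorphic to `T ∖ S`, `T ≃ₜ ℝ/ℤ × ℝ/ℤ`, `S` finite non-empty (transport of the torus
  theorem along `T ≃ₜ (Fin 2 → ℝ/ℤ)`); `HolRS.nonempty_mulEquiv_freeGroup_complexTorus_compl_finite` — the
  model `ℂ/Φ(ℤ²) ∖ S`; `HolRS.isSlimGroup_profiniteCompletion_fundamentalGroup_of_homeomorph_torus_compl_finite`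
  — hence SLIM (centre-free) `π̂₁`.
* ★ `HolRS.exists_pslQuotient_iso_of_biholomorphic_torus_minus_finite_freeGroup` — **the Möbius deck group
  of every Riemann surface biholomorphic to a compact genus-one surface minus `r ≥ 1` points is FREE OF
  RANK `r + 1`**, with `pslQuotient Λ̄ ≅ X` and the transport equalities — UNCONDITIONAL.
* ★★ `HolRS.isIdRigid_EA_mapsTo_of_biholomorphic_torus_minus_finite_of_finiteness` — **[AbsTopIII]
  Prop 4.2 (i) («the geometric `EA` of objects mapping to `X` is id-rigid») and Cor 4.5 (i)–(v) AT EVERY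
  CURVE OF TYPE `(1, r)`**, by print's route (uniformisation + Lemma 4.3 for free `Λ̄` of rank
  `r + 1 ≥ 2`), modulo ONLY abc-iut-L4-t14's finiteness residuals `hfin`, `hN` (resp. `hfin`, `hN'` for the
  print-faithful RC-category) — the shape of w6-d031's `isIdRigid_EA_mapsTo_puncturedTorus_of_finiteness`,
  now for all `r`.
* `HolRS.torusMinusFinite_isConnected`, `HolRS.isIdRigid_over_complexTorus_compl_finite` — at the model
  `ℂ/Φ(ℤ²) ∖ S` as an object `HolRS.ofOpens`: the SLICE `Over (E ∖ S)` is id-rigid, UNCONDITIONALLY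
  (slim `π̂₁` + abc-iut-L4-t12's `isIdRigid_over_of_isIdRigid_connectedCover`).

Everything is a theorem; no definition, no instance, no named fact.  HONEST FRAMING: `hfin`/`hN`/`hN'`
are hypotheses (classically: finite-type Fuchsian groups); MODEL ≠ reconstruction; nothing here bears on
the disputed [IUTchIII] Cor. 3.12; typed ≠ proved elsewhere.

## References

* S. Mochizuki, *Topics in Absolute Anabelian Geometry III* (2015), proof of Prop. 4.2 (i) p.106,
  Cor. 4.5 pp.107–109, Def. 4.1 (i) p.101. [MochizukiAbsTopIII2015]
* H. M. Farkas, I. Kra, *Riemann Surfaces*, 2nd ed. (1992), IV.5.5–IV.5.6, IV.6.4. [FarkasKra1992]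
* A. Hatcher, *Algebraic Topology* (2002), §1.2 Example 1.22. [HatcherAT2002]
-/

set_option autoImplicit false

noncomputable section

namespace Literature.AnabelianGeometry.AbsoluteAnabelian

namespace HolRS

open scoped _root_.Manifold _root_.ContDiff _root_.Topology UpperHalfPlane MatrixGroups
open _root_.MulAction _root_.Function _root_.Set _root_.CategoryTheory _root_.TopologicalSpace
open Matrix.ProjectiveSpecialLinearGroup (toPGL)
open Literature.Geometry.Kaehler (ComplexTorus)
open Literature.AlgebraicTopology.FundamentalGroup
open Literature.AlgebraicGeometry.Frobenioids (IsSlimGroup)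
open Literature.IUT.HodgeTheaters (profiniteCompletion)
open Literature.Topology.CoveringSpaces

/-! ### §1 `π₁` of a genus-one surface minus a non-empty finite set is free of rank `|S| + 1` -/

/-- **`π₁(Y) ≅ F_{|S|+1}` for `Y` homeomorphic to the model torus `(ℝ/ℤ)^{Fin 2}` minus a finite
non-empty `S`** (the tree's `TorusMinusFinite.nonempty_mulEquiv_freeGroup_compl_finite`, transported).
[cite: HatcherAT2002, §1.2 Example 1.22] -/
theorem nonempty_mulEquiv_freeGroup_of_homeomorph_compl_finite {Y : Type*} [TopologicalSpace Y]
    {S : Set (Fin 2 → AddCircle (1 : ℝ))} (hS : S.Finite) (hne : S.Nonempty) (φ : Y ≃ₜ ↥(Sᶜ))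
    (y : Y) : Nonempty (FundamentalGroup Y y ≃* FreeGroup (Fin (S.ncard + 1))) := by
  obtain ⟨ψ⟩ := TorusMinusFinite.nonempty_mulEquiv_freeGroup_compl_finite (ι := Fin 2) (i₀ := 0)
    (i₁ := 1) Fin.zero_ne_one (fun i => by fin_cases i <;> simp) hS hne (φ y)
  exact ⟨(φ.fundamentalGroupMulEquiv rfl).trans ψ⟩

/-- **`π₁(Y) ≅ F_{|S|+1}` for `Y` homeomorphic to `T ∖ S`, `T ≃ₜ ℝ/ℤ × ℝ/ℤ` any space homeomorphic to the
`2`-torus and `S ⊆ T` finite non-empty** (transport along `T ≃ₜ (Fin 2 → ℝ/ℤ)`).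
[cite: HatcherAT2002, §1.2 Example 1.22] -/
theorem nonempty_mulEquiv_freeGroup_of_homeomorph_torus_compl_finite {T : Type*} [TopologicalSpace T]
    (e₀ : T ≃ₜ AddCircle (1 : ℝ) × AddCircle (1 : ℝ)) {S : Set T} (hS : S.Finite) (hne : S.Nonempty)
    {Y : Type*} [TopologicalSpace Y] (φ : Y ≃ₜ ↥(Sᶜ)) (y : Y) :
    Nonempty (FundamentalGroup Y y ≃* FreeGroup (Fin (S.ncard + 1))) := by
  let Θ : T ≃ₜ (Fin 2 → AddCircle (1 : ℝ)) :=
    e₀.trans (Homeomorph.finTwoArrow (X := AddCircle (1 : ℝ))).symm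
  have hS' : (Θ '' S).Finite := hS.image Θ
  have hne' : (Θ '' S).Nonempty := hne.image Θ
  let e : ↥(Sᶜ) ≃ₜ ↥((Θ '' S)ᶜ) :=
    Θ.subtype fun x => by
      change x ∉ S ↔ Θ x ∉ Θ '' S
      rw [Θ.injective.mem_set_image]
  obtain ⟨ψ⟩ := nonempty_mulEquiv_freeGroup_of_homeomorph_compl_finite hS' hne' (φ.trans e) y
  have hcard : (Θ '' S).ncard = S.ncard := Set.ncard_image_of_injective _ Θ.injective
  exact ⟨ψ.trans (FreeGroup.freeGroupCongr (finCongr (by rw [hcard])))⟩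

/-- **`π₁(ℂ/Φ(ℤ²) ∖ S) ≅ F_{|S|+1}`** at the tree's model complex torus minus a finite non-empty set.
[cite: HatcherAT2002, §1.2 Example 1.22] -/
theorem nonempty_mulEquiv_freeGroup_complexTorus_compl_finite (Φ : (Fin 2 → ℝ) ≃L[ℝ] ℂ)
    {S : Set (ComplexTorus Φ)} (hS : S.Finite) (hne : S.Nonempty) (y : ↥(Sᶜ)) :
    Nonempty (FundamentalGroup ↥(Sᶜ) y ≃* FreeGroup (Fin (S.ncard + 1))) :=
  TorusMinusFinite.nonempty_mulEquiv_freeGroup_compl_finite (ι := Fin 2) (i₀ := 0) (i₁ := 1)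
    Fin.zero_ne_one (fun i => by fin_cases i <;> simp) hS hne y

/-- **The profinite fundamental group of a curve of type `(1, r)` is SLIM** (hence centre-free): free of
rank `r + 1 ≥ 2` ([AbsAnab] Lemma 1.3.1 for free profinite groups, the tree's
`isSlimGroup_profiniteCompletion_of_mulEquiv_freeGroup`). [cite: MochizukiAbsTopIII2015, Lemma 4.3 p.106] -/
theorem isSlimGroup_profiniteCompletion_fundamentalGroup_of_homeomorph_torus_compl_finite {T : Type*}
    [TopologicalSpace T] (e₀ : T ≃ₜ AddCircle (1 : ℝ) × AddCircle (1 : ℝ)) {S : Set T} (hS : S.Finite)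
    (hne : S.Nonempty) {Y : Type} [TopologicalSpace Y] (φ : Y ≃ₜ ↥(Sᶜ)) (y : Y) :
    IsSlimGroup (profiniteCompletion (FundamentalGroup Y y)) := by
  obtain ⟨ψ⟩ := nonempty_mulEquiv_freeGroup_of_homeomorph_torus_compl_finite e₀ hS hne φ y
  exact Literature.GroupTheory.isSlimGroup_profiniteCompletion_of_mulEquiv_freeGroup ψ
    (by have := (Set.ncard_pos hS).2 hne; omega)

/-! ### §2 The Möbius deck group of a curve of type `(1, r)` is free of rank `r + 1` -/

section Genuine

variable (X : HolRS) {T : Type} [TopologicalSpace T] [T2Space T] [CompactSpace T] [ConnectedSpace T]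
  [ChartedSpace ℂ T] [IsManifold 𝓘(ℂ, ℂ) ω T]

/-- ★ **The Möbius deck group of a curve of type `(1, r)` is free of rank `r + 1`** — UNCONDITIONAL: for
`X ∈ HolRS` biholomorphic to `T ∖ S` (`T` compact connected of genus one, `T ≃ₜ ℝ/ℤ × ℝ/ℤ`; `S` finite,
non-empty) there are a holomorphic covering `k : ℍ → X`, its Möbius deck group `Λ̄ ≤ PSL₂(ℝ)` (membership
criterion) acting freely and properly discontinuously, `Λ̄ ≃* F_{|S|+1}` (abc-iut-w6-d031's `Λ̄ ≃* π₁(X)`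
composed with `π₁(T ∖ S) ≅ F_{|S|+1}`), an isomorphism `pslQuotient Λ̄ ≅ X`, and the two transport
equalities of the object properties «maps to `pslQuotient Λ̄`» = «maps to `X`» (in `HolRS` and in
print's RC-category). [cite: MochizukiAbsTopIII2015, Definition 4.1 (i) p.101] [cite: FarkasKra1992, IV.6.4] -/
theorem exists_pslQuotient_iso_of_biholomorphic_torus_minus_finite_freeGroup
    (e₀ : T ≃ₜ AddCircle (1 : ℝ) × AddCircle (1 : ℝ)) {S : Set T} (hS : S.Finite) (hne : S.Nonempty)
    (φ : X.carrier ≃ₜ (⟨Sᶜ, hS.isClosed.isOpen_compl⟩ : Opens T))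
    (hφ : MDifferentiable 𝓘(ℂ, ℂ) 𝓘(ℂ, ℂ) φ.symm) :
    ∃ (k : ℍ → X.carrier) (Λ : Subgroup PSL2R) (_ : ProperlyDiscontinuousSMul Λ ℍ)
      (_ : IsCancelSMul Λ ℍ),
      IsCoveringMap k ∧ MDifferentiable 𝓘(ℂ, ℂ) 𝓘(ℂ, ℂ) k ∧
      (∀ q : PSL2R, q ∈ Λ ↔ ∀ τ : ℍ, k (q • τ) = k τ) ∧
      Nonempty (Λ ≃* FreeGroup (Fin (S.ncard + 1))) ∧
      Nonempty (pslQuotient Λ ≅ X) ∧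
      ((fun Y : HolRS => Nonempty (Y ⟶ pslQuotient Λ)) = fun Y : HolRS => Nonempty (Y ⟶ X)) ∧
      ((fun Y : RC => Nonempty (Y ⟶ toRC.obj (pslQuotient Λ))) =
        fun Y : RC => Nonempty (Y ⟶ toRC.obj X)) := by
  obtain ⟨p, hp, -, dp⟩ :=
    Literature.Geometry.Kaehler.RiemannSurface.exists_disc_covering_of_biholomorphic_torus_minus_finite'
      e₀ hS hne φ hφ
  obtain ⟨k, Λ₀, _, _, hk, dk, -, -, -, -, -⟩ := exists_pslQuotient_iso_of_disc_cover X hp dp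
  obtain ⟨Λ, hPD, hC, hΛ, hπ, he, hH, hR⟩ := exists_pslQuotient_iso_of_cover_transport X hk dk
  obtain ⟨y⟩ : Nonempty X.carrier := inferInstance
  obtain ⟨ψ₁⟩ := hπ y
  obtain ⟨ψ₂⟩ := nonempty_mulEquiv_freeGroup_of_homeomorph_torus_compl_finite e₀ hS hne φ y
  exact ⟨k, Λ, hPD, hC, hk, dk, hΛ, ⟨ψ₁.symm.trans ψ₂⟩, he, hH, hR⟩

/-- ★★ **[AbsTopIII] Prop 4.2 (i) and Cor 4.5 (i)–(v) AT EVERY CURVE OF TYPE `(1, r)`** (`X ∈ HolRS`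
biholomorphic to a compact genus-one surface minus `r ≥ 1` points), by print's route (uniformisation
`X ≅ ℍ/Λ̄` + Lemma 4.3 for the free Möbius deck group `Λ̄ ≅ F_{r+1}`, rank `≥ 2`): GRANTED
abc-iut-L4-t14's two finiteness residuals `hfin` (finite fibres of the conjugation-induced maps of
`Loc(PSL₂(ℝ), Λ̄)`) and `hN` (`[N(Λ̄') : Λ̄'] < ∞` for every finite-index `Λ̄' ≤ Λ̄`), the geometric `EA` of
connected Riemann surfaces mapping to `X` is ID-RIGID and the archimedean log-Frobenius data over it
satisfy Cor 4.5 AS TYPED; and, granted `hfin` and `hN' : [N_{PGL₂(ℝ)}(Λ̄) : Λ̄] < ∞`, «objects of the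
RC-category mapping to `X`» is id-rigid.  (abc-iut-w6-d031's `isIdRigid_EA_mapsTo_puncturedTorus_of_finiteness`
for `r = 1` at the model; here every `r` and every genus-one `T`.)
[cite: MochizukiAbsTopIII2015, Proposition 4.2 (i) proof p.106]
[cite: MochizukiAbsTopIII2015, Corollary 4.5 pp.107–109] -/
theorem isIdRigid_EA_mapsTo_of_biholomorphic_torus_minus_finite_of_finiteness
    (e₀ : T ≃ₜ AddCircle (1 : ℝ) × AddCircle (1 : ℝ)) {S : Set T} (hS : S.Finite) (hne : S.Nonempty)
    (φ : X.carrier ≃ₜ (⟨Sᶜ, hS.isClosed.isOpen_compl⟩ : Opens T))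
    (hφ : MDifferentiable 𝓘(ℂ, ℂ) 𝓘(ℂ, ℂ) φ.symm) :
    ∃ (Λ : Subgroup PSL2R) (_ : ProperlyDiscontinuousSMul Λ ℍ) (_ : IsCancelSMul Λ ℍ),
      Nonempty (Λ ≃* FreeGroup (Fin (S.ncard + 1))) ∧ Nonempty (pslQuotient Λ ≅ X) ∧
      ∀ hfin : ∀ (g : PSL2R) (Λ₁ Λ₂ : _root_.Literature.AnabelianGeometry.AbsoluteAnabelian.LocObj Λ),
          (∀ x ∈ Λ₁.toSubgroup, g * x * g⁻¹ ∈ Λ₂.toSubgroup) →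
          ((Literature.Geometry.Manifold.QuotientManifold.conjSubgroup g Λ₁.toSubgroup).subgroupOf
            Λ₂.toSubgroup).FiniteIndex,
        ((∀ Λ' : _root_.Literature.AnabelianGeometry.AbsoluteAnabelian.LocObj Λ,
            (Λ'.toSubgroup.subgroupOf (Subgroup.normalizer (Λ'.toSubgroup : Set PSL2R))).FiniteIndex) →
          IsIdRigid (geometricAutHolFieldFunctor fun Y : HolRS => Nonempty (Y ⟶ X)).EA ∧
            Literature.AnabelianGeometry.AbsoluteAnabelian.AbsTopIII.Cor_4_5
              (archLogFrobeniusData (geometricAutHolFieldFunctor fun Y : HolRS => Nonempty (Y ⟶ X)))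
              (archTelecoreData (geometricAutHolFieldFunctor fun Y : HolRS => Nonempty (Y ⟶ X)))) ∧
        (((Λ.map (toPGL (n := Fin 2) (R := ℝ))).subgroupOf
            (Subgroup.normalizer ((Λ.map (toPGL (n := Fin 2) (R := ℝ)) : Subgroup PGL(2, ℝ)) :
              Set PGL(2, ℝ)))).FiniteIndex →
          IsIdRigid (ObjectProperty.FullSubcategory fun Y : RC => Nonempty (Y ⟶ toRC.obj X))) := by
  obtain ⟨-, Λ, hPD, hC, -, -, -, ⟨e⟩, hiso, hH, hR⟩ :=
    exists_pslQuotient_iso_of_biholomorphic_torus_minus_finite_freeGroup X e₀ hS hne φ hφ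
  obtain ⟨hfree, hfinG, hcard⟩ := exists_isFreeGroup_of_mulEquiv e
  have h2 : 2 ≤ S.ncard + 1 := by have := (Set.ncard_pos hS).2 hne; omega
  have h2' : 2 ≤ Nat.card (IsFreeGroup.Generators Λ) := hcard ▸ h2
  refine ⟨Λ, hPD, hC, ⟨e⟩, hiso, fun hfin => ⟨fun hN => ⟨?_, ?_⟩, fun hN' => ?_⟩⟩
  · have h := isIdRigid_EA_mapsTo_pslQuotient_of_isFreeGroup Λ hfin h2' hN
    rw [hH] at h
    exact h
  · have h := cor_4_5_geometric_mapsTo_pslQuotient_of_isFreeGroup Λ hfin h2' hN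
    rw [hH] at h
    exact h
  · haveI := hN'
    have h := RC.isIdRigid_mapsTo_pslQuotient_of_mulEquiv_freeGroup Λ hfin e h2
    rw [hR] at h
    exact h

end Genuine

/-! ### §3 The model `ℂ/Φ(ℤ²) ∖ S`: the slice is id-rigid, unconditionally -/

section Model

variable (Φ : (Fin 2 → ℝ) ≃L[ℝ] ℂ) {S : Set (ComplexTorus Φ)}

/-- The complex torus minus a finite non-empty set is connected (path connected, the tree's
`TorusMinusFinite.isPathConnected_compl_finite`). [cite: MochizukiAbsTopIII2015, Definition 4.1 (i) p.101] -/
theorem isConnected_complexTorus_compl_finite (hS : S.Finite) (hne : S.Nonempty) :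
    IsConnected (((⟨Sᶜ, hS.isClosed.isOpen_compl⟩ : Opens (ComplexTorus Φ)) :
      Set (ComplexTorus Φ))) :=
  (TorusMinusFinite.isPathConnected_compl_finite (ι := Fin 2) (i₀ := 0) (i₁ := 1) Fin.zero_ne_one
    (fun i => by fin_cases i <;> simp) hS hne).isConnected

/-- **The SLICE of `HolRS` over the model curve `ℂ/Φ(ℤ²) ∖ S` of type `(1, |S|)` is id-rigid,
UNCONDITIONALLY**: every automorphism of the identity functor of `Over (E ∖ S)` (connected Riemann
surfaces holomorphic finite étale over `E ∖ S`, morphisms over `E ∖ S`) is trivial — `π̂₁(E ∖ S)` is free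
profinite of rank `|S| + 1 ≥ 2`, hence slim, so the category of connected finite covers is id-rigid
(abc-iut-L6-t18's (3ε)) and `Over 𝕏 ≌ {connected finite covers}` (abc-iut-L4-t12).  The `EA`-level
statement «objects mapping to `E ∖ S`» is `isIdRigid_EA_mapsTo_of_biholomorphic_torus_minus_finite_of_finiteness`
(modulo `hfin`, `hN`). [cite: MochizukiAbsTopIII2015, Proposition 4.2 (i) p.106] -/
theorem isIdRigid_over_complexTorus_compl_finite (hS : S.Finite) (hne : S.Nonempty) :
    IsIdRigid (Over (ofOpens (M := ComplexTorus Φ) ⟨Sᶜ, hS.isClosed.isOpen_compl⟩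
      (isConnected_complexTorus_compl_finite Φ hS hne))) := by
  set X := ofOpens (M := ComplexTorus Φ) ⟨Sᶜ, hS.isClosed.isOpen_compl⟩
    (isConnected_complexTorus_compl_finite Φ hS hne) with hX
  obtain ⟨y⟩ : Nonempty X.carrier := X.connectedSpace.toNonempty
  obtain ⟨e⟩ := nonempty_mulEquiv_freeGroup_complexTorus_compl_finite Φ hS hne y
  haveI : PathConnectedSpace X.carrier :=
    TorusMinusFinite.pathConnectedSpace_compl_finite (ι := Fin 2) (i₀ := 0) (i₁ := 1) Fin.zero_ne_one
      (fun i => by fin_cases i <;> simp) hS hne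
  haveI : StronglyLocallyContractibleSpace X.carrier :=
    Literature.AlgebraicTopology.Homotopy.stronglyLocallyContractibleSpace_of_chartedSpace_normedSpace
      ℂ X.carrier
  exact X.isIdRigid_over_of_isIdRigid_connectedCover
    (CovFin.isIdRigid_connected_of_isSlimGroup y
      (Literature.GroupTheory.isSlimGroup_profiniteCompletion_of_mulEquiv_freeGroup e
        (by have := (Set.ncard_pos hS).2 hne; omega)))

end Model

end HolRS

end Literature.AnabelianGeometry.AbsoluteAnabelian

end
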